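import Summits.Ventures.PercRepro.C025ProfileThinRowB

/-!
# THE ROW `(q, q+1)` IN THE THIN REGIME — part C: (Cap) for `q ≤ 5` and THEOREM T(q) (night-3 g13)
`proofs/NIGHT3-G13-LIFT.md` §4. With `a := #D₁(S)`, `b := #D₂(S)`, `c := #col S` (the coloops of `S`) and `m := |E ∖ S|`, the load of a
rank-`(q+1)` set `S` under the simple rule is `(a + b/(m+1))/(q+1)` (part B). If `|S| = q + 1` then `b = 0` and `a ≤ q + 1`; if
`|S| ≥ q + 3` nothing is paid; if `|S| = q + 2` then `a ≤ c`, `b ≤ c (q + 2 − c)`, `c ≤ q − 1` (three non-coloops, simplicity),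
`m + 1 ≥ q + 1` when `a ≥ 1` and `m + 1 ≥ q` when `b ≥ 1`, and the arithmetic `a + b/(m+1) ≤ q + 1` holds exactly when `q ≤ 5`
(`arith_thin`: `c (2q + 3 − c) ≤ (q+1)²` for `c ≤ q − 1`, which fails at `q = 6, c = 5`; the paper's §3 construction realises the
failure). Hence **THEOREM T(q)**, `q ≤ 5`: `profileIneq_succ_of_thin` — the row `(q, q+1)` of C-032 holds for every SIMPLE finite matroid
in which every rank-`q` set has at most `q + 1` points — with the Hall form `hallIneq_succ_of_thin` (C-033) and the instances
`(4, 5)` and `(5, 6)` written out. At `q ≤ 3` the rows are tree theorems for every finite matroid (`profileIneq_three_four`).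
-/
open scoped Matroid
namespace PercRepro
open Set Finset ThmH Staged
namespace ThinRow
variable {α : Type} [DecidableEq α] {M : Matroid α} [M.Finite]

/-- **The capacity arithmetic of the thin regime** (`q ≤ 5`): `a + b/(m+1) ≤ q + 1` when `a ≤ c`, `b ≤ c (q + 2 − c)`, `c ≤ q − 1`,
`q + 1 ≤ m + 1` if `a ≥ 1` and `q ≤ m + 1` if `b ≥ 1`. -/
theorem arith_thin {q c a b m : ℕ} (hq : q ≤ 5) (hc : c + 3 ≤ q + 2) (ha : a ≤ c) (hb : b ≤ c * (q + 2 - c))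
    (ha' : 1 ≤ a → q + 1 ≤ m + 1) (hb' : 1 ≤ b → q ≤ m + 1) :
    (a : ℚ) + (b : ℚ) / ((m : ℚ) + 1) ≤ (q : ℚ) + 1 := by
  have hm : (0 : ℚ) < (m : ℚ) + 1 := by positivity
  have hc4 : c ≤ 4 := by omega
  rcases Nat.eq_zero_or_pos a with ha0 | ha1
  · subst ha0
    rcases Nat.eq_zero_or_pos b with hb0 | hb1
    · subst hb0
      simp only [Nat.cast_zero, zero_add, zero_div]
      positivity
    · have hqm := hb' hb1
      have key : b ≤ q * (q + 1) := by
        interval_cases q <;> interval_cases c <;> omega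
      have h1 : (b : ℚ) ≤ (q : ℚ) * ((q : ℚ) + 1) := by exact_mod_cast key
      have h2 : (q : ℚ) ≤ (m : ℚ) + 1 := by exact_mod_cast hqm
      have h3 : (0 : ℚ) ≤ q := by positivity
      rw [Nat.cast_zero, zero_add, div_le_iff₀ hm]
      nlinarith
  · have hqm := ha' ha1
    have key : c * (q + 1) + c * (q + 2 - c) ≤ (q + 1) * (q + 1) := by
      interval_cases q <;> interval_cases c <;> omega
    have hq1 : (0 : ℚ) < (q : ℚ) + 1 := by positivity
    have hle : ((q : ℚ) + 1) ≤ (m : ℚ) + 1 := by exact_mod_cast hqm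
    have h1 : (b : ℚ) / ((m : ℚ) + 1) ≤ (b : ℚ) / ((q : ℚ) + 1) :=
      div_le_div_of_nonneg_left (by positivity) hq1 hle
    have hcq : ((q + 2 - c : ℕ) : ℚ) = (q : ℚ) + 2 - c := by
      rw [Nat.cast_sub (by omega)]; push_cast; ring
    have h2 : (b : ℚ) ≤ (c : ℚ) * ((q : ℚ) + 2 - c) := by
      have : (b : ℚ) ≤ ((c * (q + 2 - c) : ℕ) : ℚ) := by exact_mod_cast hb
      rw [Nat.cast_mul, hcq] at this
      exact this
    have h3 : (a : ℚ) ≤ c := by exact_mod_cast ha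
    have key' : (c : ℚ) * ((q : ℚ) + 1) + (c : ℚ) * ((q : ℚ) + 2 - c) ≤ ((q : ℚ) + 1) * ((q : ℚ) + 1) := by
      have : ((c * (q + 1) + c * (q + 2 - c) : ℕ) : ℚ) ≤ (((q + 1) * (q + 1) : ℕ) : ℚ) := by exact_mod_cast key
      rw [Nat.cast_add, Nat.cast_mul, Nat.cast_mul, hcq] at this
      push_cast at this
      linarith
    have h4 : (b : ℚ) / ((q : ℚ) + 1) ≤ (c : ℚ) * ((q : ℚ) + 2 - c) / ((q : ℚ) + 1) :=
      div_le_div_of_nonneg_right h2 hq1.le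
    have h5 : (c : ℚ) * ((q : ℚ) + 2 - c) / ((q : ℚ) + 1) ≤ (q : ℚ) + 1 - c := by
      rw [div_le_iff₀ hq1]
      linarith
    linarith

/-- **(Cap) in the thin regime for `q ≤ 5`**: every rank-`(q+1)` set of a simple thin matroid carries load at most `1`. -/
theorem cap_thin (q : ℕ) (hq : q ≤ 5) (hsimple : ∀ T ⊆ M.E, T.encard ≤ 2 → M.Indep T)
    (hthin : ∀ X ⊆ gr M, rkN M X = q → X.card ≤ q + 1) {S : Finset α} (hS : S ∈ Shadow.levelSet M (q + 1)) :
    ∑ B ∈ (Profile.Rq M q).filter (fun B => B ⊆ S),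
      ((if q + 1 ≤ crk M B ∧ ∃ x ∈ outer M B, S = insert x B then (1 : ℚ) else 0) +
        (if q + 1 ≤ crk M B ∧ crk M B = (outer M B).card + 1 ∧ ∃ x ∈ outer M B, S = insert x (clF M B) then
          1 / ((outer M B).card : ℚ) else 0)) / ((q : ℚ) + 1) ≤ 1 := by
  rw [← Finset.sum_div, div_le_one (by positivity), Finset.sum_add_distrib]
  have h1 := sum_w1_le_card_D1 (M := M) q (S := S)
  have h2 := sum_w2_le_card_D2 q hthin hS
  set D1 := S.filter (fun x => S.erase x ∈ Profile.Rq M q ∧ q + 1 ≤ crk M (S.erase x) ∧ x ∈ outer M (S.erase x))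
    with hD1
  set D2 := (S ×ˢ S).filter (fun xy => xy.1 ≠ xy.2 ∧ (S.erase xy.1).erase xy.2 ∈ Profile.Rq M q ∧
      q + 1 ≤ crk M ((S.erase xy.1).erase xy.2) ∧
      crk M ((S.erase xy.1).erase xy.2) = (outer M ((S.erase xy.1).erase xy.2)).card + 1 ∧
      xy.1 ∈ outer M ((S.erase xy.1).erase xy.2) ∧ S = insert xy.1 (clF M ((S.erase xy.1).erase xy.2))) with hD2
  set col := S.filter (fun x => rkN M (S.erase x) + 1 = rkN M S) with hcol
  set m := (gr M \ S).card with hm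
  have hD1col : D1 ⊆ col := D1_subset_col hS
  have hD2sub : D2 ⊆ col ×ˢ (S \ col) := by
    intro xy hxy
    have hf := mem_D2_facts hthin hS hxy
    have hxy' := Finset.mem_product.mp (Finset.mem_filter.mp hxy).1
    rw [Finset.mem_product, Finset.mem_sdiff]
    exact ⟨Finset.mem_filter.mpr ⟨hxy'.1, hf.2.2.2.2.1⟩, hxy'.2,
      fun h => hf.2.2.2.2.2 (Finset.mem_filter.mp h).2⟩
  have hSq : rkN M S = q + 1 := rkN_eq_iff.mpr (Profile.mem_levelSet.mp hS).2
  have hScard_ge : q + 1 ≤ S.card := hSq ▸ rkN_le_card S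
  have key : (D1.card : ℚ) + (D2.card : ℚ) / ((m : ℚ) + 1) ≤ (q : ℚ) + 1 := by
    rcases Nat.lt_or_ge S.card (q + 2) with hlt | hge
    · -- `|S| = q + 1`: no short pair, at most `|S|` demanding coloops
      have hD2e : D2 = ∅ := by
        rw [Finset.eq_empty_iff_forall_notMem]
        intro xy hxy
        have := (mem_D2_facts hthin hS hxy).2.2.1
        omega
      have hD1c : D1.card ≤ q + 1 := (Finset.card_le_card (Finset.filter_subset _ _)).trans (by omega)
      rw [hD2e, Finset.card_empty, Nat.cast_zero, zero_div, add_zero]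
      exact_mod_cast hD1c
    rcases Nat.lt_or_ge S.card (q + 3) with hlt2 | hge2
    · -- `|S| = q + 2`: the arithmetic of the thin regime
      have hScard : S.card = q + 2 := by omega
      have hc := card_col_add_three_le hsimple hS hScard
      rw [hScard] at hc
      have ha : D1.card ≤ col.card := Finset.card_le_card hD1col
      have hb : D2.card ≤ col.card * (q + 2 - col.card) := by
        have := Finset.card_le_card hD2sub
        rw [Finset.card_product, Finset.card_sdiff_of_subset (Finset.filter_subset _ _), hScard] at this
        exact this
      have ha' : 1 ≤ D1.card → q + 1 ≤ m + 1 := by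
        intro h
        obtain ⟨x, hx⟩ := Finset.card_pos.mp h
        exact (card_of_mem_D1 hthin hS hx).2
      have hb' : 1 ≤ D2.card → q ≤ m + 1 := by
        intro h
        obtain ⟨xy, hxy⟩ := Finset.card_pos.mp h
        exact (mem_D2_facts hthin hS hxy).2.2.2.1
      exact arith_thin hq hc ha hb ha' hb'
    · -- `|S| ≥ q + 3`: nothing is paid
      have hD1e : D1 = ∅ := by
        rw [Finset.eq_empty_iff_forall_notMem]
        intro x hx
        have := (card_of_mem_D1 hthin hS hx).1
        omega
      have hD2e : D2 = ∅ := by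
        rw [Finset.eq_empty_iff_forall_notMem]
        intro xy hxy
        have := (mem_D2_facts hthin hS hxy).2.2.1
        omega
      rw [hD1e, hD2e, Finset.card_empty, Finset.card_empty, Nat.cast_zero, zero_div, add_zero]
      positivity
  linarith

/-- **THEOREM T(q), `q ≤ 5` (C-032, the row `(q, q+1)` in the thin regime)**: for every simple finite matroid in which every rank-`q`
set has at most `q + 1` points, `(q+1)·#{S : ρ(S) = q+1} ≥ Σ_{B : ρ(B) = q, ρ(E∖B) ≥ q+1} ρ(E∖B)`. -/
theorem profileIneq_succ_of_thin (q : ℕ) (hq : q ≤ 5) (hsimple : ∀ T ⊆ M.E, T.encard ≤ 2 → M.Indep T)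
    (hthin : ∀ X ⊆ gr M, rkN M X = q → X.card ≤ q + 1) : Profile.ProfileIneq M q (q + 1) :=
  profileIneq_of_cert q (q + 1)
    (fun B S => ((if q + 1 ≤ crk M B ∧ ∃ x ∈ outer M B, S = insert x B then (1 : ℚ) else 0) +
        (if q + 1 ≤ crk M B ∧ crk M B = (outer M B).card + 1 ∧ ∃ x ∈ outer M B, S = insert x (clF M B) then
          1 / ((outer M B).card : ℚ) else 0)) / ((q : ℚ) + 1))
    (fun _ hS => cap_thin q hq hsimple hthin hS) (fun _ hB => dem_thin q hthin hB)

/-- The simple rule is nonnegative. -/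
theorem wThin_nonneg (q : ℕ) (B S : Finset α) :
    (0 : ℚ) ≤ ((if q + 1 ≤ crk M B ∧ ∃ x ∈ outer M B, S = insert x B then (1 : ℚ) else 0) +
        (if q + 1 ≤ crk M B ∧ crk M B = (outer M B).card + 1 ∧ ∃ x ∈ outer M B, S = insert x (clF M B) then
          1 / ((outer M B).card : ℚ) else 0)) / ((q : ℚ) + 1) := by
  apply div_nonneg _ (by positivity)
  apply add_nonneg
  · split_ifs <;> norm_num
  · split_ifs <;> positivity

/-- **THEOREM T(q), Hall form (C-033)**: for every family `𝒜` of rank-`q` sets of a simple thin matroid, `q ≤ 5`,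
`Σ_{B ∈ 𝒜} ρ(E∖B)/(q+1) ≤ #{S : ρ(S) = q+1, S ⊇ some B ∈ 𝒜}`. -/
theorem hallIneq_succ_of_thin (q : ℕ) (hq : q ≤ 5) (hsimple : ∀ T ⊆ M.E, T.encard ≤ 2 → M.Indep T)
    (hthin : ∀ X ⊆ gr M, rkN M X = q → X.card ≤ q + 1) : Profile.HallIneq M q (q + 1) :=
  hallIneq_of_cert q (q + 1)
    (fun B S => ((if q + 1 ≤ crk M B ∧ ∃ x ∈ outer M B, S = insert x B then (1 : ℚ) else 0) +
        (if q + 1 ≤ crk M B ∧ crk M B = (outer M B).card + 1 ∧ ∃ x ∈ outer M B, S = insert x (clF M B) then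
          1 / ((outer M B).card : ℚ) else 0)) / ((q : ℚ) + 1))
    (fun B S => wThin_nonneg q B S) (fun _ hS => cap_thin q hq hsimple hthin hS) (fun _ hB => dem_thin q hthin hB)

/-- **THEOREM T(4)**: the row `(4, 5)` of (Π) — `5·#{S : ρ(S) = 5} ≥ Σ_{B : ρ(B) = 4, ρ(E∖B) ≥ 5} ρ(E∖B)` — for every simple finite
matroid in which every rank-`4` set has at most `5` points. -/
theorem profileIneq_four_five_of_thin (hsimple : ∀ T ⊆ M.E, T.encard ≤ 2 → M.Indep T)
    (hthin : ∀ X ⊆ gr M, rkN M X = 4 → X.card ≤ 5) : Profile.ProfileIneq M 4 5 :=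
  profileIneq_succ_of_thin 4 (by norm_num) hsimple hthin

/-- **THEOREM T(5)**: the row `(5, 6)` of (Π) for every simple finite matroid in which every rank-`5` set has at most `6` points. -/
theorem profileIneq_five_six_of_thin (hsimple : ∀ T ⊆ M.E, T.encard ≤ 2 → M.Indep T)
    (hthin : ∀ X ⊆ gr M, rkN M X = 5 → X.card ≤ 6) : Profile.ProfileIneq M 5 6 :=
  profileIneq_succ_of_thin 5 (by norm_num) hsimple hthin

/-- The Hall form of the row `(4, 5)` in the thin regime. -/
theorem hallIneq_four_five_of_thin (hsimple : ∀ T ⊆ M.E, T.encard ≤ 2 → M.Indep T)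
    (hthin : ∀ X ⊆ gr M, rkN M X = 4 → X.card ≤ 5) : Profile.HallIneq M 4 5 :=
  hallIneq_succ_of_thin 4 (by norm_num) hsimple hthin

/-- The Hall form of the row `(5, 6)` in the thin regime. -/
theorem hallIneq_five_six_of_thin (hsimple : ∀ T ⊆ M.E, T.encard ≤ 2 → M.Indep T)
    (hthin : ∀ X ⊆ gr M, rkN M X = 5 → X.card ≤ 6) : Profile.HallIneq M 5 6 :=
  hallIneq_succ_of_thin 5 (by norm_num) hsimple hthin

omit [DecidableEq α] in
/-- The thin hypothesis follows from its FLAT form: if every rank-`q` flat of `M` has at most `q + 1` points then so does every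
rank-`q` subset of the ground set. -/
theorem thin_of_flats {q : ℕ} (hF : ∀ F ⊆ gr M, M.IsFlat (F : Set α) → rkN M F = q → F.card ≤ q + 1) :
    ∀ X ⊆ gr M, rkN M X = q → X.card ≤ q + 1 := by
  intro X hXg hX
  have h1 : X.card ≤ (clF M X).card := Finset.card_le_card (subset_clF_self hXg)
  have h2 : (clF M X).card ≤ q + 1 := by
    apply hF _ (clF_subset_gr X) _ (by rw [rkN_clF, hX])
    rw [coe_clF]
    exact M.isFlat_closure _
  omega

/-- **THEOREM T(4), flat form**: the row `(4, 5)` for every simple finite matroid whose rank-`4` flats have at most `5` points. -/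
theorem profileIneq_four_five_of_thin_flats (hsimple : ∀ T ⊆ M.E, T.encard ≤ 2 → M.Indep T)
    (hF : ∀ F ⊆ gr M, M.IsFlat (F : Set α) → rkN M F = 4 → F.card ≤ 5) : Profile.ProfileIneq M 4 5 :=
  profileIneq_four_five_of_thin hsimple (thin_of_flats hF)

/-- **THEOREM T(5), flat form**: the row `(5, 6)` for every simple finite matroid whose rank-`5` flats have at most `6` points. -/
theorem profileIneq_five_six_of_thin_flats (hsimple : ∀ T ⊆ M.E, T.encard ≤ 2 → M.Indep T)
    (hF : ∀ F ⊆ gr M, M.IsFlat (F : Set α) → rkN M F = 5 → F.card ≤ 6) : Profile.ProfileIneq M 5 6 :=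
  profileIneq_five_six_of_thin hsimple (thin_of_flats hF)

end ThinRow
end PercRepro
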